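import Literature.AlgebraicGeometry.Motives.LinesGenerateChowOneLinear
import Mathlib.LinearAlgebra.Matrix.NonsingularInverse
import Mathlib.RingTheory.MvPolynomial.EulerIdentity
import HarnessLib

/-!
# The Hessian of a quadratic form and the Jacobian criterion

For a quadratic form `F(x₀, …, x_N)` over a field: the Hessian matrix `M`
(`Mⱼₗ =` coefficient of `xₗ` in the linear form `∂F/∂xⱼ`) is symmetric, `∂F/∂xⱼ = Σₗ Mⱼₗ xₗ`,
`2F(v) = vᵀMv` (Euler's identity, Mathlib `IsHomogeneous.sum_X_mul_pderiv`), and the Jacobian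
criterion `IsNonsingularSystem` for the one-equation system `{F}` makes `v ↦ Mv` injective when
`2 ≠ 0` (`mulVec_hessian_injective`: a kernel vector would be a point of the cone at which all
partials vanish, tested at the prime `ker (eval v)`). Input of the normal forms of quadrics
(`Motives/SplitQuadricNormalForm`, `Motives/QuadricNormalForm`).

Everything is proved; no named facts.

## References

* R. Hartshorne, *Algebraic Geometry*, I Ex. 5.8 (Jacobian criterion). [Hartshorne1977]
-/

noncomputable section

open CategoryTheory AlgebraicGeometry Order

universe u

namespace Literature.AlgebraicGeometry.Motives

namespace ProjectiveSpaceCells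

open _root_.MvPolynomial Matrix

section Hessian

variable {k : Type u} [Field k] {N : ℕ} {F : MvPolynomial (Fin (N + 1)) k}

/-- **The Hessian rows of a quadratic form**: `hessian F j l` is the coefficient of `xₗ` in the
linear form `∂F/∂xⱼ`. [folklore] -/
def hessian (F : MvPolynomial (Fin (N + 1)) k) : Matrix (Fin (N + 1)) (Fin (N + 1)) k :=
  Matrix.of fun j l ↦ MvPolynomial.coeff (Finsupp.single l 1) (MvPolynomial.pderiv j F)

/-- `∂F/∂xⱼ = Σₗ Mⱼₗ xₗ` for a quadratic form `F`. [folklore] -/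
theorem pderiv_eq_lin_hessian (hF : F.IsHomogeneous 2) (j : Fin (N + 1)) :
    MvPolynomial.pderiv j F = lin (hessian F j) :=
  eq_lin_of_isHomogeneous_one (hF.pderiv (i := j))

/-- The Hessian matrix is symmetric. [folklore] -/
theorem hessian_apply_comm (j l : Fin (N + 1)) : hessian F j l = hessian F l j := by
  classical
  simp only [hessian, Matrix.of_apply]
  rw [MvPolynomial.coeff_pderiv, MvPolynomial.coeff_pderiv, add_comm (Finsupp.single l 1),
    Finsupp.single_apply, Finsupp.single_apply]
  by_cases h : j = l
  · rw [h]
  · rw [if_neg h, if_neg (Ne.symm h)]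

/-- The Hessian matrix is symmetric (matrix form). [folklore] -/
theorem hessian_transpose : (hessian F)ᵀ = hessian F := by
  ext j l
  rw [Matrix.transpose_apply]
  exact hessian_apply_comm l j

/-- Evaluating `Σ vⱼ xⱼ` at `x = u` is the dot product. [folklore] -/
theorem eval_lin (v u : Fin (N + 1) → k) : MvPolynomial.eval u (lin v) = v ⬝ᵥ u := by
  simp [lin, map_sum, dotProduct]

/-- **Euler: `2 F(v) = vᵀ M v`** for the Hessian `M` of a quadratic form `F`. [folklore] -/
theorem two_mul_eval_eq (hF : F.IsHomogeneous 2) (v : Fin (N + 1) → k) :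
    2 * MvPolynomial.eval v F = v ⬝ᵥ (hessian F *ᵥ v) := by
  have h := congrArg (MvPolynomial.eval v) hF.sum_X_mul_pderiv
  simp only [map_sum, map_mul, MvPolynomial.eval_X, nsmul_eq_mul, Nat.cast_ofNat, map_ofNat] at h
  rw [← h, dotProduct]
  refine Finset.sum_congr rfl fun j _ ↦ ?_
  rw [pderiv_eq_lin_hessian hF j, eval_lin, Matrix.mulVec, dotProduct]

/-- `∂F/∂xⱼ (v) = (M v)ⱼ`. [folklore] -/
theorem eval_pderiv_eq (hF : F.IsHomogeneous 2) (v : Fin (N + 1) → k) (j : Fin (N + 1)) :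
    MvPolynomial.eval v (MvPolynomial.pderiv j F) = (hessian F *ᵥ v) j := by
  rw [pderiv_eq_lin_hessian hF j, eval_lin]; rfl

/-- **The Jacobian criterion makes the Hessian nondegenerate**: if `M v = 0` for `v ≠ 0` then
`v` is a point of the cone `F = 0` at which all `∂F/∂xⱼ` vanish, and the prime `ker (eval v)`
violates `IsNonsingularSystem` (`char k ≠ 2`). [cite: Hartshorne1977, I Ex. 5.8] -/
theorem mulVec_hessian_injective (hF : F.IsHomogeneous 2) (h2 : (2 : k) ≠ 0)
    (hJ : IsNonsingularSystem k (fun _ : Fin 1 ↦ F)) :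
    Function.Injective (hessian F).mulVec := by
  classical
  intro v w hvw
  rw [← sub_eq_zero]
  set u := v - w with hu
  have hMu : hessian F *ᵥ u = 0 := by rw [hu, Matrix.mulVec_sub, hvw, sub_self]
  -- the prime `ker (eval u)`
  let 𝔭 : Ideal (MvPolynomial (Fin (N + 1)) k) := RingHom.ker (MvPolynomial.eval u)
  have h𝔭 : 𝔭.IsPrime := RingHom.ker_isPrime _
  have hF𝔭 : ∀ a : Fin 1, (fun _ ↦ F) a ∈ 𝔭 := fun _ ↦ by
    change MvPolynomial.eval u F = 0
    have h := two_mul_eval_eq hF u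
    rw [hMu, dotProduct_zero] at h
    exact (mul_eq_zero.mp h).resolve_left h2
  have hmin : ∀ r : Fin 1 → Fin (N + 1), jacobianMinor (fun _ : Fin 1 ↦ F) r ∈ 𝔭 := fun r ↦ by
    rw [jacobianMinor_of_unique]
    change MvPolynomial.eval u (MvPolynomial.pderiv (r default) F) = 0
    rw [eval_pderiv_eq hF, hMu]; rfl
  funext j
  have hj := hJ 𝔭 h𝔭 hF𝔭 hmin j
  change MvPolynomial.eval u (MvPolynomial.X j) = 0 at hj
  rwa [MvPolynomial.eval_X] at hj

end Hessian

end ProjectiveSpaceCells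

end Literature.AlgebraicGeometry.Motives
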